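import Summits.KontsevichZagierPeriods.KontsevichZagierPeriods.Statement
import Summits.KontsevichZagierPeriods.KontsevichZagierPeriods.Theses.HermiteRigidity
import Summits.KontsevichZagierPeriods.KontsevichZagierPeriods.Theorems.TypeAGenerationConjecture
import Literature.NumberTheory.Transcendental.AyoubPeriodSeries
import Literature.NumberTheory.Transcendental.AyoubPeriodSeriesDescent
import Literature.NumberTheory.Transcendental.AyoubPeriodSeriesLocalizing

/-!
# Line skeleton — crux `AyoubEffectiveCubeKernel` (stmt-KontsevichZagierPeriods-18116, route HermiteRigidity; piece X₂ of the split of `ReductionRigidity` stmt-3407)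

Crux-strategist re-audit r1.  X₂ = Ayoub 2015 Conj. 1.1 / Fresán 2024 Conj. 3.5 at `k = ℚ` (type-(a)
generation of `ker ∫_{[0,1]^∞}` on `𝒪_{ℚ-alg}(𝔻̄^∞)`), a PRINTED OPEN CONJECTURE of period-conjecture
strength in kind.  Its honest skeleton is the LOCALISATION CUT inside Ayoub's algebra — the cut along which
Ayoub's own relative theorem is proved (AyoubRelKZRevisited Thm. 1.11: injectivity only after inverting
`2πi`; tree fact `AyoubRel.ayoub_integration_injective_localized`, with `(2πi)^N = ∫ perGermPow`
realisable in disjoint variables, `AyoubRel.exists_disjoint_intC_eq_two_pi_I_pow`) and along which the hub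
cuts the KZ-side kernel form (AyoubSpecialisation 0540/0541, `summit_iff_ayoubPiLocalKernel_and_ayoubPiCancellation`),
here transported to the `𝒪_{ℚ-alg}` side where NO such items exist:

* `stub_oanLocalizedKernel` (conjecture-grade, GPC strength "after inverting 2πi"; the half that torsor
  methods reach in the relative case): `∫ F = 0 ⇒ ∃ N, ∃ g ∈ 𝒪_{ℚ-alg}` in variables disjoint from `F`
  with `∫ g = (2πi)^N` and `g·F` in the `ℚ`-span of the type-(a) elements;
* `stub_oanPiCancellation` (transcendence-free "regular element" property of Ayoub's presented module
  `𝒪_{ℚ-alg} ⧸ ⟨type (a)⟩_ℚ`: multiplication by a disjoint realisation of `(2πi)^N` is injective modulo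
  the type-(a) span) — the exact analogue of `PiCancellation` (stmt-0540) one presentation over;
* `AyoubEffectiveCubeKernel_of : stub_oanLocalizedKernel → stub_oanPiCancellation → AyoubEffectiveCubeKernel`.

Both stubs are consequences of X₂ (the first with `N = 0`, `g = 1`: `stub_oanLocalizedKernel_of_ayoub`
below; the second because the type-(a) span integrates to `0`, `AyoubRel.intC_relAC_eq_zero`, and
`∫ (g F) = ∫ g · ∫ F`, `AyoubRel.intC_mul_of_disjoint`), and neither is cheaply equivalent to X₂ or to the
summit (probes in `bc/`).  Also recorded: X₂ is, on the nose, the summit-side conjecture leaf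
`TypeAGenerationConjecture` (`ayoubEffectiveCubeKernel_iff_typeAGenerationConjecture`), through
`AyoubRel.typeAGeneration_forall_iff_rat` and `algebraMap ℚ ℂ = Rat.castHom ℂ` (`rfl`).
-/

noncomputable section

-- `Summit.KontsevichZagierPeriods.KontsevichZagierPeriods.…` is the tree's mandated layout (single-conjunct summit).
set_option linter.dupNamespace false

namespace Summit.KontsevichZagierPeriods.KontsevichZagierPeriods.Cruxes.AyoubEffectiveCubeKernel.LocaliseAtTwoPiI

open Literature.NumberTheory.Transcendental
open Literature.NumberTheory.Transcendental.AyoubRel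
open Summit.KontsevichZagierPeriods.KontsevichZagierPeriods.Theses.HermiteRigidity (AyoubEffectiveCubeKernel)

/-- STUB (conjecture-grade) — **the kernel after inverting `2πi`, inside `𝒪_{ℚ-alg}(𝔻̄^∞)`**: if
`∫ F = 0` then some disjoint realisation `g` of a power `(2πi)^N` multiplies `F` into the `ℚ`-span of the
type-(a) elements.  (Shape of AyoubRelKZRevisited Thm. 1.11 for CONSTANT families with the type-(b)
generators removed; the relative theorem itself has no absolute content because `F · 1` is of type (b).)
[cite: AyoubRelKZRevisited, Théorème 1.11, Notation 1.9 (iii)] [cite: Ayoub2015, Conj. 1.1] -/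
theorem stub_oanLocalizedKernel : ∀ F ∈ Oan (Rat.castHom ℂ), intC F = 0 →
    ∃ (N : ℕ) (g : CSeries), g ∈ Oan (Rat.castHom ℂ) ∧ (∀ i, ¬ (UsesVar g i ∧ UsesVar F i)) ∧
      intC g = (2 * Real.pi * Complex.I) ^ N ∧
      g * F ∈ kSpan (Rat.castHom ℂ) {x : CSeries | ∃ G ∈ Oan (Rat.castHom ℂ), ∃ i : ℕ, x = relAC i G} := by
  sorry

/-- STUB (transcendence-free, conjecture-grade) — **`2πi`-cancellation in Ayoub's presented module**:
if a disjoint realisation `g` of `(2πi)^N` multiplies `F ∈ 𝒪_{ℚ-alg}` into the `ℚ`-span of the type-(a)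
elements, then `F` itself lies in that span (injectivity of `𝒫^{eff} → 𝒫^{eff}[(2πi)⁻¹]` on Ayoub's
presentation; the motivic shadow `P̃^{eff} → P̃` is printed as OPEN, Huber–Wüstholz 2022 App. A).
[cite: AyoubRelKZRevisited, Notation 1.9 (ii)–(iii)] [cite: HuberWustholz2022, App. A] -/
theorem stub_oanPiCancellation : ∀ F ∈ Oan (Rat.castHom ℂ), ∀ (N : ℕ) (g : CSeries),
    g ∈ Oan (Rat.castHom ℂ) → (∀ i, ¬ (UsesVar g i ∧ UsesVar F i)) →
    intC g = (2 * Real.pi * Complex.I) ^ N →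
    g * F ∈ kSpan (Rat.castHom ℂ) {x : CSeries | ∃ G ∈ Oan (Rat.castHom ℂ), ∃ i : ℕ, x = relAC i G} →
    F ∈ kSpan (Rat.castHom ℂ) {x : CSeries | ∃ G ∈ Oan (Rat.castHom ℂ), ∃ i : ℕ, x = relAC i G} := by
  sorry

/-- **THE COMPOSITION** (registered form): the route crux `AyoubEffectiveCubeKernel` BY NAME from the two stubs
of this line, discharged inside the proof. [cite: Ayoub2015, Conj. 1.1] [folklore] -/
theorem AyoubEffectiveCubeKernel_of : AyoubEffectiveCubeKernel := by
  intro F hF h0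
  obtain ⟨N, g, hg, hdisj, hint, hspan⟩ := stub_oanLocalizedKernel F hF h0
  exact stub_oanPiCancellation F hF N g hg hdisj hint hspan

/-- Sanity: the localised-kernel stub is a CONSEQUENCE of X₂ (`N = 0`, `g = 1`). [folklore] -/
theorem stub_oanLocalizedKernel_of_ayoub (h : AyoubEffectiveCubeKernel) :
    ∀ F ∈ Oan (Rat.castHom ℂ), intC F = 0 →
      ∃ (N : ℕ) (g : CSeries), g ∈ Oan (Rat.castHom ℂ) ∧ (∀ i, ¬ (UsesVar g i ∧ UsesVar F i)) ∧
        intC g = (2 * Real.pi * Complex.I) ^ N ∧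
        g * F ∈ kSpan (Rat.castHom ℂ) {x : CSeries | ∃ G ∈ Oan (Rat.castHom ℂ), ∃ i : ℕ, x = relAC i G} := by
  intro F hF h0
  refine ⟨0, 1, one_mem_Oan _, fun i ⟨h1, _⟩ => ?_, by simp, by simpa using h F hF h0⟩
  obtain ⟨a, ha, hc⟩ := h1
  apply hc
  rw [MvPowerSeries.coeff_one, if_neg]
  rintro rfl
  exact ha (by simp)

/-- `algebraMap ℚ ℂ` is `Rat.castHom ℂ` (definitionally). [folklore] -/
theorem algebraMap_rat_complex_eq : (algebraMap ℚ ℂ : ℚ →+* ℂ) = Rat.castHom ℂ := rfl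

/-- **X₂ is the summit-side conjecture leaf `TypeAGenerationConjecture`** (Ayoub's Conj. 1.1 for every
`k` with algebraic image ⇔ Fresán's `k = ℚ` form, `AyoubRel.typeAGeneration_forall_iff_rat`).  Recorded
so that the ledger's conjecture bookkeeping sees the child as that leaf; the child's statement itself
names no conjecture constant. [cite: Ayoub2015, Conj. 1.1] [cite: Fresan2024, Conj. 3.5] -/
theorem ayoubEffectiveCubeKernel_iff_typeAGenerationConjecture :
    AyoubEffectiveCubeKernel ↔ TypeAGenerationConjecture :=
  typeAGeneration_forall_iff_rat.symm

end Summit.KontsevichZagierPeriods.KontsevichZagierPeriods.Cruxes.AyoubEffectiveCubeKernel.LocaliseAtTwoPiI
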